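import Mathlib.GroupTheory.DoubleCoset
import Literature.AnabelianGeometry.SemiGraphs.PreimageComponentObject
import Literature.AnabelianGeometry.SemiGraphs.PreimageComponentConnected
import Literature.AnabelianGeometry.SemiGraphs.FiniteEtaleCoveringDictionaryProofs2b
import Literature.AnabelianGeometry.SemiGraphs.GraphOfAnabelioidsGalois
import Literature.AnabelianGeometry.Anabelioids.ComponentsOrbits
import Literature.AnabelianGeometry.Anabelioids.OrbitsDoubleCosets
import HarnessLib

/-!
# Components of `φ⁻¹(ℍ)` ↔ double cosets `Π_ℍ \ Π_𝒢 / Π′` ([SemiAnbd] §2, proof of Cor. 2.7 (i), p. 30)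

Mochizuki, *Semi-graphs of anabelioids*, Publ. RIMS **42** (2006), §2, proof of Corollary 2.7 (i),
p. 30: for the finite étale covering `𝒢′ → 𝒢` attached to `A ∈ B(𝒢)`, "whose restriction to `ℍ` … we
denote by `ℋ′ → ℍ`", the connected components `ℋ″` of `ℋ′` are permuted by `Π_𝒢` and classified by the
double cosets of the decomposition groups [cite: MochizukiSemiAnbd2006, Cor. 2.7(i) p.30];
[SemiAnbd] Remark 2.2.1 p. 24 (vertices / components upstairs = orbits = double cosets).

PROOF-ONLY (abc-iut cell, L3 row «D3a» = clauses (P1)+(P2) of the dictionary fact (D3)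
`covering_subgraphComponents_doubleCosets` of `FiniteEtaleCoveringDictionary.lean`, abc-iut-L3-d3;
brick M3b, abc-iut-w5-d041, SECOND to abc-iut-L6-t17's M1/M2):

* `range_map_eq_orbit_of_isConnected` — the fibre-image of a morphism out of a CONNECTED object is
  one `Aut F`-orbit;
* `exists_rep_doubleCoset_bijective_eq_one` — representatives of a bijection onto `PH \ G / K` can be
  re-chosen with a prescribed element represented by `1`;
* `covering_subgraphComponents_count` (and `…_count_one`, `…_doubleCosets_count`) — **(P1) + (P2)**: under `𝒢`, `𝒢′` connected, `φ` the finite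
  étale covering attached to `A` (local description `IsFiniteEtaleCoveringOf` AND global clause
  `IsGlobalCoveringOf`), `ℍ ∋ v = φ v′` a connected sub-graph, and `Π′ = Stab(x₀)`, there is
  `d : {components K of φ⁻¹(ℍ)} → Π_𝒢` with `K ↦ Π_ℍ · d(K) · Π′` a BIJECTION onto `Π_ℍ \ Π_𝒢 / Π′`, and
  the component through `v′` exists.  Assembly: M1 (`PreimageComponents`: components = reachability
  classes), M2 (`PreimageComponentObject`: the sub-object `Z_K ↪ A|_ℍ`), M3a
  (`PreimageComponentConnected`: `Z_K` connected), components ↔ orbits (`ComponentsOrbits`), the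
  transitivity of `Π_𝒢` on the fibre of the connected `A` (`isConnected_of_isGlobalCovering`), and
  abc-iut-L6-t17's `doubleCoset_mk_right_stabilizer_eq_iff` (double cosets with `Stab(x₀)` on the right
  are `Π_ℍ`-orbits).

Typed ≠ proved for the printed objects; nothing here takes a side on [IUTchIII] Cor. 3.12.
-/

namespace Literature.AnabelianGeometry.SemiGraphs

open CategoryTheory CategoryTheory.Limits CategoryTheory.PreGaloisCategory
open Literature.AnabelianGeometry.Anabelioids

universe w v₁ u₁ u

/-! ### Fibre-images of connected objects are orbits -/

/-- The fibre-image of a morphism out of a CONNECTED object of a Galois category is the `Aut F`-orbit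
of any of its points ([SGA1] V; `Aut F` acts transitively on the fibre of a connected object).
[cite: MochizukiSemiAnbd2006, Rem. 2.2.1 p.24] -/
theorem range_map_eq_orbit_of_isConnected {C : Type u₁} [Category.{v₁} C] [GaloisCategory C]
    (F : C ⥤ FintypeCat.{w}) [FiberFunctor F] {Z X : C} [IsConnected Z] (f : Z ⟶ X) (z₀ : F.obj Z) :
    Set.range (F.map f) = MulAction.orbit (Aut F) (F.map f z₀) := by
  ext y
  constructor
  · rintro ⟨z, rfl⟩
    obtain ⟨σ, hσ⟩ := MulAction.exists_smul_eq (Aut F) z₀ z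
    refine ⟨σ, ?_⟩
    change σ • F.map f z₀ = F.map f z
    rw [mulAction_def, ← hσ, mulAction_def]
    have h := ConcreteCategory.congr_hom (σ.hom.naturality f) z₀
    simp only [FintypeCat.comp_apply] at h
    exact h
  · rintro ⟨σ, rfl⟩
    refine ⟨σ • z₀, ?_⟩
    change F.map f (σ • z₀) = σ • F.map f z₀
    rw [mulAction_def, mulAction_def]
    have h := ConcreteCategory.congr_hom (σ.hom.naturality f) z₀
    simp only [FintypeCat.comp_apply] at h
    exact h.symm

/-- **Normalising representatives**: a bijection `S → PH \ G / K` realised by representatives can be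
re-chosen so that a given `s₀ ∈ S` is represented by `1` (compose with the transposition of the
classes of `f s₀` and `1`).  Used to make the component through the base vertex go to the class of
`Π′` in (D3). [cite: MochizukiSemiAnbd2006, Cor. 2.7(i) p.30] -/
theorem exists_rep_doubleCoset_bijective_eq_one {G : Type*} [Group G] (PH K : Subgroup G)
    {S : Type*} (f : S → DoubleCoset.Quotient (PH : Set G) K) (hf : Function.Bijective f) (s₀ : S) :
    ∃ d : S → G, Function.Bijective (fun s => DoubleCoset.mk PH K (d s)) ∧ d s₀ = 1 := by
  classical
  let β : S → DoubleCoset.Quotient (PH : Set G) K :=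
    fun s => Equiv.swap (f s₀) (DoubleCoset.mk PH K 1) (f s)
  have hβ : Function.Bijective β := (Equiv.swap _ _).bijective.comp hf
  refine ⟨fun s => if s = s₀ then 1 else (β s).out, ?_, by simp⟩
  have hrep : (fun s => DoubleCoset.mk PH K (if s = s₀ then 1 else (β s).out)) = β := by
    funext s
    by_cases hs : s = s₀
    · subst hs
      rw [if_pos rfl]
      exact (Equiv.swap_apply_left _ _).symm
    · rw [if_neg hs]
      exact DoubleCoset.out_eq' _ _ _
  rw [hrep]
  exact hβ

namespace SemiGraphOfAnabelioids

variable {𝒢 𝒢' : SemiGraphOfAnabelioids.{v₁, u₁, u}}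

/-! ### (P1) + (P2) of the dictionary fact (D3) -/

/-- **Components of `φ⁻¹(ℍ)` ↔ `Π_ℍ \ Π_𝒢 / Stab(x₀)`** (clauses (P1) and (P2) of (D3),
`covering_subgraphComponents_doubleCosets`, with the subgroup `Π′` of (D1) entered through its value
`Stab(x₀)`).  For `𝒢`, `𝒢′` connected, `φ : 𝒢′ → 𝒢` the finite étale covering attached to `A ∈ B(𝒢)` (local
description and global clause), a vertex `v′` of `𝒢′` with basepoints `F′`, `F` and `e`, a connected
sub-GRAPH `ℍ ∋ v = φ v′`, and `x₀` a point of the fibre `F(A_v)`: there is `d : {K} → Π_𝒢` on the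
preimage components `K` of `ℍ` such that `K ↦ Π_ℍ · d(K) · Stab(x₀)` is a bijection onto the double
cosets, and the component through `v′` exists.  (`d(K)` carries `x₀` into the fibre-image of the
connected sub-object `Z_K ↪ A|_ℍ`; injectivity: one `Π_ℍ`-orbit = one component of `A|_ℍ` = one set of
components `cV w″` over `v` = one `K`; surjectivity: every point of `F(A_v)` lies in some `cV w″`, and
`w″` lies in a component.) [cite: MochizukiSemiAnbd2006, Cor. 2.7(i) p.30] -/
theorem covering_subgraphComponents_count (h𝒢 : 𝒢.IsConnected) (h𝒢' : 𝒢'.IsConnected)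
    (φ : Hom 𝒢' 𝒢) (A : 𝒢.BObj) (hloc : φ.IsFiniteEtaleCoveringOf A) (hB : φ.IsGlobalCoveringOf A)
    (v' : 𝒢'.graph.Vertex) (F : 𝒢.V (φ.base.vertexMap v') ⥤ FintypeCat.{v₁}) [FiberFunctor F]
    (H : 𝒢.graph.Subgraph) (hH : H.toSemiGraph.IsConnected) (hHg : H.toSemiGraph.IsGraph)
    (hv : φ.base.vertexMap v' ∈ H.verts) (x₀ : (𝒢.ρ (φ.base.vertexMap v') ⋙ F).obj A) :
    ∃ d : {K : 𝒢'.graph.Subgraph // φ.IsPreimageComponent H K} → 𝒢.Pi (φ.base.vertexMap v') F,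
      Function.Bijective (fun K => DoubleCoset.mk (𝒢.piHToPi H ⟨φ.base.vertexMap v', hv⟩ F).range
        (MulAction.stabilizer (𝒢.Pi (φ.base.vertexMap v') F) x₀) (d K)) ∧
      ∃ K₀ : {K : 𝒢'.graph.Subgraph // φ.IsPreimageComponent H K}, v' ∈ K₀.1.verts := by
  classical
  -- Galois structures on `B(𝒢)` and `B(𝒢_ℍ)`, basepoints through `v`
  letI := 𝒢.preGaloisCategory_bObj
  letI := 𝒢.galoisCategory_bObj h𝒢
  letI := (𝒢.restrict H).preGaloisCategory_bObj
  letI := (𝒢.restrict H).galoisCategory_bObj ⟨hH⟩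
  let v : 𝒢.graph.Vertex := φ.base.vertexMap v'
  let vH : H.toSemiGraph.Vertex := ⟨v, hv⟩
  let Φ : 𝒢.BObj ⥤ FintypeCat.{v₁} := 𝒢.ρ v ⋙ F
  haveI : FiberFunctor Φ := 𝒢.fiberFunctor_ρ h𝒢 v F
  let ΦH : (𝒢.restrict H).BObj ⥤ FintypeCat.{v₁} := (𝒢.restrict H).ρ vH ⋙ F
  haveI : FiberFunctor ΦH :=
    @SemiGraphOfAnabelioids.fiberFunctor_ρ (𝒢.restrict H) ⟨hH⟩ vH F ‹FiberFunctor F›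
  let AH : (𝒢.restrict H).BObj := (𝒢.restrictFunctor H).obj A
  let PH : Subgroup (Aut Φ) := (𝒢.piHToPi H vH F).range
  -- the fibres `Φ_ℍ(A|_ℍ)` and `Φ(A)` are the same set `X = F(A_v)`; we keep the two types apart
  let ι₀ : ΦH.obj AH → Φ.obj A := fun x => x
  have hι₀_smul : ∀ (σ : Aut ΦH) (x : ΦH.obj AH), (𝒢.piHToPi H vH F σ) • ι₀ x = ι₀ (σ • x) :=
    fun σ x => rfl
  -- the local data of the covering
  obtain ⟨hprop, cV, cE, hVbij, hEbij, -, -, hbr⟩ := hloc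
  -- `A` is connected, so `Π_𝒢 = Aut Φ` acts transitively on `X = F(A_v)`
  haveI hA : PreGaloisCategory.IsConnected A := isConnected_of_isGlobalCovering h𝒢' φ A hB
  -- (P2): the component through `v′`
  obtain ⟨K₀, hK₀, hv'K₀⟩ := φ.exists_isPreimageComponent_mem H v' hv hprop hHg
  -- the sub-object `Z_K ↪ A|_ℍ` of each component (M2), connected (M3a)
  have hZ : ∀ K : {K : 𝒢'.graph.Subgraph // φ.IsPreimageComponent H K},
      ∃ (Z : (𝒢.restrict H).BObj) (m : Z ⟶ AH), Mono m ∧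
        (∀ (w : H.toSemiGraph.Vertex) (Fw : 𝒢.V w.1 ⥤ FintypeCat.{v₁}) [FiberFunctor Fw]
            (y : Fw.obj (A.S w.1)),
          y ∈ Set.range (Fw.map (m.fS w)) ↔ ∃ P : π₀Obj (A.S w.1),
            (∃ w'' ∈ K.1.verts, (⟨φ.base.vertexMap w'', cV w''⟩ : Σ v, π₀Obj (A.S v)) = ⟨w.1, P⟩) ∧
              y ∈ Set.range (Fw.map P.1.arrow)) ∧
        ∀ (e : H.toSemiGraph.Edge) (Fe : 𝒢.E e.1 ⥤ FintypeCat.{v₁}) [FiberFunctor Fe]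
            (x : Fe.obj (A.T e.1)),
          x ∈ Set.range (Fe.map (m.fT e)) ↔ ∃ Q : π₀Obj (A.T e.1),
            (∃ e'' ∈ K.1.edges, (⟨φ.base.edgeMap e'', cE e''⟩ : Σ e, π₀Obj (A.T e)) = ⟨e.1, Q⟩) ∧
              x ∈ Set.range (Fe.map Q.1.arrow) :=
    fun K => exists_preimageComponentObject φ A cV cE hVbij hEbij hbr hprop H hHg K.1 K.2
  choose Z m hmono hmS hmT using hZ
  have hZc : ∀ K, PreGaloisCategory.IsConnected (Z K) := fun K =>
    isConnected_of_preimageComponent_ranges φ A cV cE hbr H K.1 K.2 (Z K) (m K) (hmS K) (hmT K)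
  -- a point `z_K` of the fibre of `Z_K` over `v`, and its image `y_K ∈ X`
  have hz : ∀ K, Nonempty (ΦH.obj (Z K)) := fun K =>
    haveI := hZc K
    nonempty_fiber_of_isConnected ΦH (Z K)
  let z : ∀ K, ΦH.obj (Z K) := fun K => Classical.choice (hz K)
  let yH : ∀ K, ΦH.obj AH := fun K => ΦH.map (m K) (z K)
  let y : ∀ K, Φ.obj A := fun K => ι₀ (yH K)
  -- `d K` carries `x₀` to `y_K` (transitivity of `Π_𝒢` on the fibre of the connected `A`)
  have hd : ∀ K, ∃ g : Aut Φ, g • x₀ = y K := fun K => MulAction.exists_smul_eq (Aut Φ) x₀ (y K)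
  choose d hdK using hd
  -- the `Π_ℍ`-orbit of `y_K` is the fibre-image of the connected `Z_K` over `v`
  have horbit : ∀ (K) (x : ΦH.obj AH), ι₀ x ∈ MulAction.orbit PH (y K) ↔
      x ∈ Set.range (ΦH.map (m K)) := by
    intro K x
    haveI := hZc K
    rw [range_map_eq_orbit_of_isConnected ΦH (m K) (z K), MulAction.mem_orbit_iff,
      MulAction.mem_orbit_iff]
    constructor
    · rintro ⟨⟨_, ⟨σ, rfl⟩⟩, hx⟩
      change (𝒢.piHToPi H vH F σ) • y K = ι₀ x at hx
      rw [hι₀_smul] at hx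
      exact ⟨σ, hx⟩
    · rintro ⟨σ, hσ⟩
      refine ⟨⟨_, ⟨σ, rfl⟩⟩, ?_⟩
      change (𝒢.piHToPi H vH F σ) • y K = ι₀ x
      rw [hι₀_smul]
      exact congrArg ι₀ hσ
  -- reading the fibre-image of `Z_K` over `v`: points come from components `cV w″`, `w″ ∈ K` over `v`
  have hread : ∀ (K) (x : ΦH.obj AH), x ∈ Set.range (ΦH.map (m K)) ↔
      ∃ P : π₀Obj (A.S v), (∃ w'' ∈ K.1.verts,
        (⟨φ.base.vertexMap w'', cV w''⟩ : Σ v, π₀Obj (A.S v)) = ⟨v, P⟩) ∧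
          ι₀ x ∈ Set.range (F.map P.1.arrow) := fun K x => hmS K vH F x
  refine ⟨d, ⟨?_, ?_⟩, ⟨K₀, hK₀⟩, hv'K₀⟩
  · -- injectivity
    intro K₁ K₂ h12
    have he := (doubleCoset_mk_right_stabilizer_eq_iff x₀ PH (d K₁) (d K₂)).mp h12
    rw [hdK K₁, hdK K₂] at he
    -- `y_{K₂}` lies in the fibre-images of both `Z_{K₁}` and `Z_{K₂}`
    have hy2 : yH K₂ ∈ Set.range (ΦH.map (m K₁)) := (horbit K₁ (yH K₂)).mp he
    have hy2' : yH K₂ ∈ Set.range (ΦH.map (m K₂)) := ⟨z K₂, rfl⟩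
    obtain ⟨P₁, ⟨w₁, hw₁, hσ₁⟩, hP₁⟩ := (hread K₁ _).mp hy2
    obtain ⟨P₂, ⟨w₂, hw₂, hσ₂⟩, hP₂⟩ := (hread K₂ _).mp hy2'
    have hP : P₁ = P₂ := component_eq_of_mem_range F P₁ P₂ hP₁ hP₂
    subst hP
    have hw : w₁ = w₂ := hVbij.1 (hσ₁.trans hσ₂.symm)
    subst hw
    exact Subtype.ext (Hom.IsPreimageComponent.eq_of_mem K₁.2 K₂.2 hw₁ hw₂)
  · -- surjectivity
    intro q
    obtain ⟨g, rfl⟩ : ∃ g, DoubleCoset.mk PH (MulAction.stabilizer (Aut Φ) x₀) g = q :=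
      ⟨q.out, DoubleCoset.out_eq' _ _ q⟩
    -- the point `g • x₀ ∈ X`, read in `Φ_ℍ(A|_ℍ)`
    let xg : ΦH.obj AH := g • x₀
    have hxg : ι₀ xg = g • x₀ := rfl
    -- the component of `A_v` containing `g • x₀`, and the vertex `w″` of `𝒢′` it names
    obtain ⟨P, hP⟩ := exists_component_mem_range F (X := A.S v) (ι₀ xg)
    obtain ⟨w'', hσ⟩ := hVbij.2 ⟨v, P⟩
    have hφw : φ.base.vertexMap w'' = v := congrArg Sigma.fst hσ
    have hw''H : φ.base.vertexMap w'' ∈ H.verts := by rw [hφw]; exact hv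
    -- the component `K ∋ w″` of `φ⁻¹(ℍ)` (M1)
    obtain ⟨K, hK, hw''K⟩ := φ.exists_isPreimageComponent_mem H w'' hw''H hprop hHg
    refine ⟨⟨K, hK⟩, ?_⟩
    -- `g • x₀` lies in the fibre-image of `Z_K`, i.e. in the `Π_ℍ`-orbit of `y_K`
    have hgx : xg ∈ Set.range (ΦH.map (m ⟨K, hK⟩)) :=
      (hread ⟨K, hK⟩ xg).mpr ⟨P, ⟨w'', hw''K, hσ⟩, hP⟩
    have he : ι₀ xg ∈ MulAction.orbit PH (y ⟨K, hK⟩) := (horbit ⟨K, hK⟩ xg).mpr hgx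
    rw [hxg, ← hdK ⟨K, hK⟩] at he
    exact (doubleCoset_mk_right_stabilizer_eq_iff x₀ PH (d ⟨K, hK⟩) g).mpr he

/-- (P1) + (P2) with the component through `v′` NORMALISED to the representative `1` (so that it goes
to the class of `Π′ = Stab(x₀)`, as (P3) of (D3) wants): re-choice of representatives by
`exists_rep_doubleCoset_bijective_eq_one`. [cite: MochizukiSemiAnbd2006, Cor. 2.7(i) p.30] -/
theorem covering_subgraphComponents_count_one (h𝒢 : 𝒢.IsConnected) (h𝒢' : 𝒢'.IsConnected)
    (φ : Hom 𝒢' 𝒢) (A : 𝒢.BObj) (hloc : φ.IsFiniteEtaleCoveringOf A) (hB : φ.IsGlobalCoveringOf A)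
    (v' : 𝒢'.graph.Vertex) (F : 𝒢.V (φ.base.vertexMap v') ⥤ FintypeCat.{v₁}) [FiberFunctor F]
    (H : 𝒢.graph.Subgraph) (hH : H.toSemiGraph.IsConnected) (hHg : H.toSemiGraph.IsGraph)
    (hv : φ.base.vertexMap v' ∈ H.verts) (x₀ : (𝒢.ρ (φ.base.vertexMap v') ⋙ F).obj A) :
    ∃ d : {K : 𝒢'.graph.Subgraph // φ.IsPreimageComponent H K} → 𝒢.Pi (φ.base.vertexMap v') F,
      Function.Bijective (fun K => DoubleCoset.mk (𝒢.piHToPi H ⟨φ.base.vertexMap v', hv⟩ F).range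
        (MulAction.stabilizer (𝒢.Pi (φ.base.vertexMap v') F) x₀) (d K)) ∧
      ∃ K₀ : {K : 𝒢'.graph.Subgraph // φ.IsPreimageComponent H K}, v' ∈ K₀.1.verts ∧ d K₀ = 1 := by
  obtain ⟨d, hd, K₀, hK₀⟩ := covering_subgraphComponents_count h𝒢 h𝒢' φ A hloc hB v' F H hH hHg hv x₀
  obtain ⟨d', hd', h1⟩ := exists_rep_doubleCoset_bijective_eq_one _ _ _ hd K₀
  exact ⟨d', hd', K₀, hK₀, h1⟩

/-- **(D3a) in the shape of the dictionary fact** (the binders of `covering_subgraphComponents_doubleCosets`,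
`FiniteEtaleCoveringDictionary.lean`, abc-iut-L3-d3 — clauses (P1) and (P2); the group clauses (P3),
(P4) are the separate fact «D3b»): for every identification `ι(Π_{𝒢′}) = Stab(x₀)` ((D1)), the
components of `φ⁻¹(ℍ)` are in bijection with `Π_ℍ \ Π_𝒢 / ι(Π_{𝒢′})` and the component through `v′`
exists. [cite: MochizukiSemiAnbd2006, Cor. 2.7(i) p.30] -/
theorem covering_subgraphComponents_doubleCosets_count
    (𝒢 𝒢' : SemiGraphOfAnabelioids.{v₁, u₁, u}) (φ : Hom 𝒢' 𝒢) (A : 𝒢.BObj)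
    (h𝒢 : 𝒢.IsConnected) (h𝒢' : 𝒢'.IsConnected) (hloc : φ.IsFiniteEtaleCoveringOf A)
    (hB : φ.IsGlobalCoveringOf A)
    (v' : 𝒢'.graph.Vertex) (F' : 𝒢'.V v' ⥤ FintypeCat.{v₁}) [FiberFunctor F']
    (F : 𝒢.V (φ.base.vertexMap v') ⥤ FintypeCat.{v₁}) [FiberFunctor F]
    (e : (φ.φV v').pullback ⋙ F' ≅ F)
    (H : 𝒢.graph.Subgraph) (hH : H.toSemiGraph.IsConnected) (hHg : H.toSemiGraph.IsGraph)
    (hv : φ.base.vertexMap v' ∈ H.verts)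
    (x₀ : (𝒢.ρ (φ.base.vertexMap v') ⋙ F).obj A)
    (hx₀ : ((Aut.autMulEquivOfIso (Functor.isoWhiskerLeft (𝒢.ρ (φ.base.vertexMap v')) e)
        ).toMonoidHom.comp (pi1Map φ.pullbackFunctor (𝒢'.ρ v' ⋙ F'))).range =
      MulAction.stabilizer (𝒢.Pi (φ.base.vertexMap v') F) x₀) :
    ∃ d : {K : 𝒢'.graph.Subgraph // φ.IsPreimageComponent H K} → 𝒢.Pi (φ.base.vertexMap v') F,
      Function.Bijective (fun K => DoubleCoset.mk (𝒢.piHToPi H ⟨φ.base.vertexMap v', hv⟩ F).range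
        ((Aut.autMulEquivOfIso (Functor.isoWhiskerLeft (𝒢.ρ (φ.base.vertexMap v')) e)
          ).toMonoidHom.comp (pi1Map φ.pullbackFunctor (𝒢'.ρ v' ⋙ F'))).range (d K)) ∧
      ∃ K₀ : {K : 𝒢'.graph.Subgraph // φ.IsPreimageComponent H K}, v' ∈ K₀.1.verts := by
  rw [hx₀]
  exact covering_subgraphComponents_count h𝒢 h𝒢' φ A hloc hB v' F H hH hHg hv x₀

end SemiGraphOfAnabelioids

end Literature.AnabelianGeometry.SemiGraphs
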